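import Summits.NavierStokesRegularity.NavierStokesRegularity.Theorems.ExtremiserTransienceTwoThirdsTranslateAverage
import HarnessLib

/-!
# Route `ExtremiserTransience`, crux `NearExtremalTransiencePerFlow` (stmt-NavierStokesRegularity-26567),
# LINE g10-1 «two_thirds» (ns-idea-10), stub S1a′ — BRICK 3b, lemma (iv): the τ-AVERAGE OF THE LAYER WEIGHTS is a shell volume

`--supports stmt-NavierStokesRegularity-26567` (helper; prover seat ns-net-p2 g12; design = evidence #59 on ⟨26567⟩).  The light-layer clause (iii) of
`IsGoodBall` and the layer junk of brick 2 are controlled on AVERAGE over the translates of the packing: for any finite measure `μ` (in S1a′: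
the bulk measure `(zd + wd) dx`) and radii `0 ≤ s ≤ s'`,

* `lintegral_measure_ball_eq` — `∫ μ(B(c, ρ)) dc = vol(B_ρ) · μ(ℝ³)` (Tonelli; the `G = ∅` case of brick 4a's `lintegral_indicator_measure_ball_eq`);
* `lintegral_measure_layer_eq` — `∫ (μ(B(c, s')) − μ(B(c, s))) dc = (vol B_{s'} − vol B_s) · μ(ℝ³)`;
* `setLIntegral_tsum_lattice_layer_eq` — the same integral written as `∫_{τ ∈ Q_b} Σ_{g ∈ Λ_b} (μ(B(g+τ, s')) − μ(B(g+τ, s))) dτ`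
  (fundamental domain, brick 4a `lintegral_eq_setLIntegral_tsum_lattice`).
So the per-translate sums of layer weights have τ-average `(vol B_{s'} − vol B_s)·μ(ℝ³)/vol(Q_b)` — for `s' = s + s^{7/8}` and spacing `4s` a
fraction `≲ s^{-1/8}` of the total bulk.  HONEST FRAMING: measure theory; nothing about Navier–Stokes is proved; no summit is proved by a line. [folklore]
-/

noncomputable section

open scoped Topology ENNReal NNReal
open MeasureTheory Filter Set Metric Function

namespace Summit.NavierStokesRegularity.NavierStokesRegularity.Theorems.NearExtremalTransiencePerFlow.TwoThirds

-- the problem directory repeats the summit name (`NavierStokesRegularity/NavierStokesRegularity`)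
set_option linter.dupNamespace false
set_option linter.style.longLine false

/-- `c ↦ μ(B(c, ρ))` is measurable (s-finite `μ`). -/
theorem measurable_measure_ball (μ : Measure (EuclideanSpace ℝ (Fin 3))) [SFinite μ] (ρ : ℝ) :
    Measurable fun c : EuclideanSpace ℝ (Fin 3) => μ (Metric.ball c ρ) := by
  have hS : MeasurableSet {p : EuclideanSpace ℝ (Fin 3) × EuclideanSpace ℝ (Fin 3) | dist p.2 p.1 < ρ} :=
    measurableSet_lt (continuous_snd.dist continuous_fst).measurable measurable_const
  exact measurable_measure_prodMk_left (ν := μ) hS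

/-- **`∫ μ(B(c, ρ)) dc = vol(B_ρ) · μ(ℝ³)`.** -/
theorem lintegral_measure_ball_eq (μ : Measure (EuclideanSpace ℝ (Fin 3))) [SFinite μ] (ρ : ℝ) :
    ∫⁻ c, μ (Metric.ball c ρ) = volume (Metric.ball (0 : EuclideanSpace ℝ (Fin 3)) ρ) * μ Set.univ := by
  have h := lintegral_indicator_measure_ball_eq μ MeasurableSet.empty ρ
  simp only [Set.compl_empty, Set.indicator_univ, Set.univ_inter] at h
  rw [h]
  calc ∫⁻ y, volume (Metric.ball y ρ) ∂μ = ∫⁻ _y, volume (Metric.ball (0 : EuclideanSpace ℝ (Fin 3)) ρ) ∂μ :=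
        lintegral_congr fun y => Measure.addHaar_ball_center volume y ρ
    _ = volume (Metric.ball (0 : EuclideanSpace ℝ (Fin 3)) ρ) * μ Set.univ := lintegral_const _

/-- **`∫ (μ(B(c, s')) − μ(B(c, s))) dc = (vol B_{s'} − vol B_s) · μ(ℝ³)`** for a finite measure and `s ≤ s'`. -/
theorem lintegral_measure_layer_eq (μ : Measure (EuclideanSpace ℝ (Fin 3))) [IsFiniteMeasure μ] {s s' : ℝ} (hss' : s ≤ s') :
    ∫⁻ c, (μ (Metric.ball c s') - μ (Metric.ball c s)) =
      (volume (Metric.ball (0 : EuclideanSpace ℝ (Fin 3)) s') - volume (Metric.ball (0 : EuclideanSpace ℝ (Fin 3)) s)) * μ Set.univ := by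
  have hle : (fun c : EuclideanSpace ℝ (Fin 3) => μ (Metric.ball c s)) ≤ fun c => μ (Metric.ball c s') :=
    fun c => measure_mono (Metric.ball_subset_ball hss')
  have hfin : ∫⁻ c, μ (Metric.ball c s) ≠ ⊤ := by
    rw [lintegral_measure_ball_eq]
    exact ENNReal.mul_ne_top measure_ball_lt_top.ne (measure_ne_top μ _)
  rw [lintegral_sub (measurable_measure_ball μ s) hfin (Eventually.of_forall hle), lintegral_measure_ball_eq, lintegral_measure_ball_eq,
    ENNReal.sub_mul (fun _ _ => measure_ne_top μ _)]

/-- **Lattice form**: `∫_{τ ∈ Q_b} Σ_{g ∈ Λ_b} (μ(B(g+τ, s')) − μ(B(g+τ, s))) dτ = (vol B_{s'} − vol B_s) · μ(ℝ³)`. -/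
theorem setLIntegral_tsum_lattice_layer_eq (μ : Measure (EuclideanSpace ℝ (Fin 3))) [IsFiniteMeasure μ] {s s' : ℝ} (hss' : s ≤ s')
    (b : Module.Basis (Fin 3) ℝ (EuclideanSpace ℝ (Fin 3))) :
    ∫⁻ τ in ZSpan.fundamentalDomain b, ∑' g : (Submodule.span ℤ (Set.range b)).toAddSubgroup,
        (μ (Metric.ball ((g : EuclideanSpace ℝ (Fin 3)) + τ) s') - μ (Metric.ball ((g : EuclideanSpace ℝ (Fin 3)) + τ) s)) =
      (volume (Metric.ball (0 : EuclideanSpace ℝ (Fin 3)) s') - volume (Metric.ball (0 : EuclideanSpace ℝ (Fin 3)) s)) * μ Set.univ := by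
  rw [← lintegral_measure_layer_eq μ hss']
  exact (lintegral_eq_setLIntegral_tsum_lattice b ((measurable_measure_ball μ s').sub (measurable_measure_ball μ s))).symm

end Summit.NavierStokesRegularity.NavierStokesRegularity.Theorems.NearExtremalTransiencePerFlow.TwoThirds

end
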